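import Literature.NumberTheory.Automorphic.Liu2021.AppendixC.HeckePushPullPackageInjective
import HarnessLib

/-!
# The level package of ONE normal pair `N ≤ K` with a FAITHFUL deck action (Liu 2021 §4.2 / App. C; Milne 2005 §5; Lang VIII §6)

Topic `NumberTheory/Automorphic/Liu2021/AppendixC`; namespace `Literature.NumberTheory.Automorphic.Liu2021.AppendixC`.
A PROOF FILE (theorems only: no definition ∕ structure ∕ instance ∕ named fact ∕ `sorry`), a corollary leaf of ★
`HeckeTranslateLevelQuotient` (ed. 2, `exists_finite_isSepQuotient_map'`) and ★ `HeckePushPullPackageInjective` (`isSepQuotient_kerLift`,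
`exists_pushPull_package_inj`).  Cell `hodgecm-mathlib` (D-0151), d6 `stub_RosH` glue, (C) «the whole second half at the GS tower»
(A-p18 (g12) 2026-08-30T06:28Z, producer (S1)).  COUNT-NEUTRAL capital: HC_CM is proved only modulo the 7 printed citations until rung 0
closes.

## What
★ `exists_pushPull_package_inj` CHOOSES a normal level `N` under `K` adapted to a generator `[Kγ₀K]`.  The (G4Σ) glue needs the same
package AT A GIVEN normal pair `N ≤ K` (every refined level `N″_γ ≤ K` of the transposed word, and the `hWd` bridge «every `T_k` is some
`act δ`»):

* `Sec42Data.HeckeTranslates.exists_levelPackage_inj` — for `N ≤ K` with `N` normalised by `K` and the level-quotient universal property of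
  `u^N_K : X_N → X_K` w.r.t. the translates `T_k`, `k ∈ K` (`hUP`, the shape of ★ `exists_finite_isSepQuotient_map'`): a FINITE NON-EMPTY
  group `Δ` with an INJECTIVE action `act : Δ →* Aut X_N` (the faithful quotient `(K ∕ N) ∕ ker`, ★ `isSepQuotient_kerLift`) such that
  every `act δ` is a translate `T_k` (`k ∈ K`) and every `T_k` (`k ∈ K`) is some `act δ`; the Albanese trace `t : A_K → A_N` pinned by
  `Alb_u ≫ t = Σ_δ Alb(act δ)` ([Lang1983AbelianVarieties] VIII §6 Thm. 13, ★ `Albanese.exists_trace_of_isSepQuotient_complex`); and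
  `u^N_K` a quotient of `X_N` by `act` for separated test objects ([MumfordAV1970] §7 Remark).

## References
* [Liu2021] Y. Liu, *Fourier–Jacobi cycles and arithmetic relative trace formula*, Camb. J. Math. 9 (2021); §4.2 (FJcycle.tex l. 2060–2074).
* [Milne2005ShimuraVarieties] J. S. Milne, *Introduction to Shimura varieties* (2005), §5 p. 57 L7–12, p. 58 L3–11, Rem. 5.29 (c) p. 65.
* [Lang1983AbelianVarieties] S. Lang, *Abelian Varieties* (1983), Ch. VIII §6 Thm. 13 (pp. 224–227).
* [MumfordAV1970] D. Mumford, *Abelian Varieties* (1970), §7 Thm. p. 66 and Remark.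
-/

set_option autoImplicit false

noncomputable section

open CategoryTheory AlgebraicGeometry NumberField MulAction
open Literature.AlgebraicGeometry.Motives

namespace Literature.NumberTheory.Automorphic.Liu2021.AppendixC

variable {F E : Type} [Field F] [NumberField F] [IsTotallyReal F] [Field E] [NumberField E] [Algebra F E]
  [IsTotallyComplex E] [Algebra.IsQuadraticExtension F E]
variable {P5 : PropC5Data F E} {isotropicAt : ℕ → Prop}

namespace Sec42Data.HeckeTranslates

variable {C : Sec42Data P5 isotropicAt} (T : C.HeckeTranslates)

/-- **THE LEVEL PACKAGE OF ONE NORMAL PAIR `N ≤ K` WITH AN INJECTIVE DECK ACTION.**  Given `N ≤ K`, `N` normalised by `K` (`hn`) and the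
level-quotient universal property of `u^N_K : X_N → X_K` for the translates `T_k`, `k ∈ K` (`hUP`): a FINITE NON-EMPTY group `Δ` with an
INJECTIVE action `act : Δ →* Aut X_N` such that (i) every `act δ` is some translate `T_k`, `k ∈ K`, (ii) every `T_k`, `k ∈ K`, is some
`act δ`, (iii) an Albanese trace `t : A_K → A_N` with `Alb_u ≫ t = Σ_δ Alb(act δ)`, and (iv) `u^N_K` is a quotient of `X_N` by `act` for
separated test objects.  (★ `exists_finite_isSepQuotient_map'` gives `K ∕ N` with (i)(ii)(iv); ★ `isSepQuotient_kerLift` passes to the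
faithful quotient `(K ∕ N) ∕ ker`, on which (i)(ii) persist (`kerLift_mk`); the trace is ★ `Albanese.exists_trace_of_isSepQuotient_complex`
for that finite faithful action.)  = the inside of ★ `exists_pushPull_package_inj` WITHOUT choosing `N` — the package the (G4Σ) glue
consumes at every refined normal level `N″_γ ≤ K`. [cite: Liu2021, §4.2 (FJcycle.tex l. 2074)]
[cite: Lang1983AbelianVarieties, Ch. VIII §6, Thm. 13 (pp. 224–227)] [cite: Milne2005ShimuraVarieties, §5 p. 57 L7–12, p. 58 L3–11 and Rem. 5.29 (c) p. 65]
[cite: MumfordAV1970, §7 Thm. p. 66 (Remark)] -/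
theorem exists_levelPackage_inj (τ : E →+* ℂ) ⦃N K : C5.SmallLevel C.S.K₀⦄ (hNK : N ≤ K) (hn : ∀ k ∈ K.1.1, C5.HeckeLE k N N)
    (hUP : ∀ (W : SchemeOver E) (f : C.X N ⟶ W), IsSeparated W.hom →
      (∀ (k : C.G) (hk : k ∈ K.1.1), T.tr k N N (hn k hk) ≫ f = f) → ∃! fbar : C.X K ⟶ W, C.cpt.X.map (homOfLE hNK) ≫ fbar = f) :
    ∃ (Δ : Type) (_ : Group Δ) (_ : Fintype Δ) (_ : Nonempty Δ) (act : Δ →* Aut (C.X N))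
      (_ : Function.Injective act)
      (_ : ∀ δ, ∃ (k : C.G) (hk : k ∈ K.1.1), (act δ).hom = T.tr k N N (hn k hk))
      (_ : ∀ (k : C.G) (hk : k ∈ K.1.1), ∃ δ, (act δ).hom = T.tr k N N (hn k hk))
      (t : C.A K ⟶ C.A N)
      (_ : (C.alb N).map (C.alb K) (C.cpt.X.map (homOfLE hNK)) ≫ t = ∑ δ, (C.alb N).map (C.alb N) (act δ).hom),
      IsSepQuotient (fun δ => act δ) (C.cpt.X.map (homOfLE hNK)) := by
  classical
  obtain ⟨Δ, instG, instF, act, hact, hsurj, hq⟩ := T.exists_finite_isSepQuotient_map' hNK hn hUP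
  -- the faithful quotient `Δ ∕ ker act` and its quotient property
  have hq' : IsSepQuotient (fun g => QuotientGroup.kerLift act g) (C.cpt.X.map (homOfLE hNK)) := isSepQuotient_kerLift act hq
  letI : Fintype (Δ ⧸ act.ker) := Fintype.ofFinite _
  -- the Albanese trace pinned on the faithful group (Lang VIII §6 Thm. 13)
  letI : Algebra E ℂ := τ.toAlgebra
  haveI := C.cpt.smooth_X N
  haveI := C.cpt.smooth_X K
  obtain ⟨t, ht⟩ := Albanese.exists_trace_of_isSepQuotient_complex (dX := P5.n - 1) (dY := P5.n - 1) (C.cpt.projective_X N)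
    (C.cpt.projective_X K) (QuotientGroup.kerLift act) (C.cpt.X.map (homOfLE hNK)) hq' (C.alb N) (C.alb K)
  refine ⟨Δ ⧸ act.ker, inferInstance, inferInstance, ⟨1⟩, QuotientGroup.kerLift act, QuotientGroup.kerLift_injective act,
    fun δ => ?_, fun k hk => ?_, t, ht, hq'⟩
  · obtain ⟨d, rfl⟩ := QuotientGroup.mk_surjective δ
    rw [QuotientGroup.kerLift_mk]
    exact hact d
  · obtain ⟨d, hd⟩ := hsurj k hk
    exact ⟨QuotientGroup.mk d, by rw [QuotientGroup.kerLift_mk]; exact hd⟩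

/-- **The same package from the GLOBAL level-quotient universal property** (the `hUP` binder of ★ `exists_pushPull_package(_inj)`, all normal
pairs at once — e.g. ★ `levelQuotientUP_GS` of the unitary Shimura curve), specialised to the given pair.
[cite: Liu2021, §4.2 (FJcycle.tex l. 2074)] [cite: Milne2005ShimuraVarieties, §5 p. 57 L7–12 and Rem. 5.29 (c) p. 65] -/
theorem exists_levelPackage_inj' (τ : E →+* ℂ)
    (hUP : ∀ ⦃N₁ K₁ : C5.SmallLevel C.S.K₀⦄ (h₁ : N₁ ≤ K₁) (hn₁ : ∀ k ∈ K₁.1.1, C5.HeckeLE k N₁ N₁)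
      (W : SchemeOver E) (f : C.X N₁ ⟶ W), IsSeparated W.hom →
      (∀ (k : C.G) (hk : k ∈ K₁.1.1), T.tr k N₁ N₁ (hn₁ k hk) ≫ f = f) → ∃! fbar : C.X K₁ ⟶ W, C.cpt.X.map (homOfLE h₁) ≫ fbar = f)
    ⦃N K : C5.SmallLevel C.S.K₀⦄ (hNK : N ≤ K) (hn : ∀ k ∈ K.1.1, C5.HeckeLE k N N) :
    ∃ (Δ : Type) (_ : Group Δ) (_ : Fintype Δ) (_ : Nonempty Δ) (act : Δ →* Aut (C.X N))
      (_ : Function.Injective act)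
      (_ : ∀ δ, ∃ (k : C.G) (hk : k ∈ K.1.1), (act δ).hom = T.tr k N N (hn k hk))
      (_ : ∀ (k : C.G) (hk : k ∈ K.1.1), ∃ δ, (act δ).hom = T.tr k N N (hn k hk))
      (t : C.A K ⟶ C.A N)
      (_ : (C.alb N).map (C.alb K) (C.cpt.X.map (homOfLE hNK)) ≫ t = ∑ δ, (C.alb N).map (C.alb N) (act δ).hom),
      IsSepQuotient (fun δ => act δ) (C.cpt.X.map (homOfLE hNK)) :=
  T.exists_levelPackage_inj τ hNK hn (hUP hNK hn)

end Sec42Data.HeckeTranslates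

end Literature.NumberTheory.Automorphic.Liu2021.AppendixC

end
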